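import Mathlib
import HarnessLib
import Summits.ABC.ABC.Theses.RibetTakahashiSplit
import Literature.NumberTheory.EllipticCurves.ModularCurve
import Literature.NumberTheory.EllipticCurves.ModularDegreeFormula
import Literature.NumberTheory.EllipticCurves.NewformPeterssonSize
import Literature.NumberTheory.EllipticCurves.SilvermanHeightCovolume
import Literature.NumberTheory.EllipticCurves.Szpiro
import Literature.NumberTheory.EllipticCurves.CongruenceNumber
import Literature.RingTheory.CompleteIntersection.NumericalCriterion

/-!
# Sketch — first lemmas of the crux idea cards for `WeightedSzpiroBound` (stmt-ABC-3272)

Ideator 2, round 1 (g2 revision 2026-08-16: K_B minimality is now among data of the SAME curve; the odd-part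
hand-over carries `T_odd`).  Card A `adjoint-selmer-wiles-defect`, Card B `two-adic-eisenstein-anchor`.
Everything here only has to ELABORATE (crux-ideate protocol); nothing is proved.
-/

noncomputable section

namespace Summit.ABC.ABC.Cruxes.WeightedSzpiroBound.Sketch

open Literature.NumberTheory.EllipticCurves
open Literature.NumberTheory.EllipticCurves.ModularForms
open Literature.RingTheory.CompleteIntersection
open scoped MatrixGroups ModularForm
open CongruenceSubgroup

/-- The geometric Tamagawa weight `T(E) = ∏_{p ∣ N, p² ∤ N} ord_p Δ_min(E)` of the crux
(component orders `#Φ_p` at the multiplicative primes; for curves semistable away from `2`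
exactly the weight appearing in `RibetTakahashiSplit.WeightedSzpiroBound`). -/
def tamWeight (W : WeierstrassCurve ℚ) : ℕ :=
  ∏ p ∈ (W.conductorNorm ℤ).primeFactors with ¬ p ^ 2 ∣ W.conductorNorm ℤ,
    (W.minimalDiscriminantNorm ℤ).factorization p

/-! ## Card A — the weighted degree bound and the transfer stub -/

/-- **C⁺ of Card A (weighted degree bound, the arithmetic form the Selmer lever talks to).**
For `E/ℚ` semistable away from `2`, some modular parametrisation datum at level `N = N_E` has
`deg ≤ C_ε · c² · N^{2+ε} · T(E)` (`c` its Manin constant).  By Ribet–Takahashi/Pollack–Weston,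
Lenstra's inequality and the Greenberg–Wiles product formula this is, prime by prime away from
the Eisenstein/`{2,3}` primes, the statement `#Ш(ad⁰E) ≤ N^{2+ε}` (the weight `T(E)` is the
Tamagawa defect, see the card). -/
def WeightedDegreeBound : Prop :=
  ∀ ε : ℝ, 0 < ε → ∃ C : ℝ, ∀ (W : WeierstrassCurve ℚ) [W.IsElliptic],
    (∀ p : ℕ, p.Prime → p ≠ 2 → ¬ p ^ 2 ∣ W.conductorNorm ℤ) →
    ∀ (N : ℕ) [NeZero N], W.conductorNorm ℤ = N →
      ∃ D : ModularParametrizationData W N,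
        (D.deg : ℝ) ≤ C * (D.c : ℝ) ^ 2 * (N : ℝ) ^ (2 + ε) * (tamWeight W : ℝ)

/-- **First lemma A0 (`stub_transfer`, provable now on the pattern of
`DegreeConjectureAbc.abcLe_of_freyDegreeBound`):** Zagier's identity
(`zagier_degree_formula_holds`, PROVED) + the Petersson lower bound (named fact) + Silverman's
covolume inequality (named fact) turn the weighted degree bound into the crux, for a global
minimal model `W₀` (pass to `W₀.baseChange ℚ`, whose Néron lattice is the datum's lattice up to
the unit `u ∈ {±1}` since `W₀` is minimal at every prime). -/
def transferA : Prop :=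
  murty_petersson_newform_lower_bound → silverman1986_discriminant_c4_covolume →
    WeightedDegreeBound → Summit.ABC.ABC.Theses.RibetTakahashiSplit.WeightedSzpiroBound

/-- **First lemma A1 (the lever's first step, abstract; a ten-line corollary of two PROVED tree
theorems `PollackWeston.span_pairing_self_eq_congruenceIdeal` and
`length_congruenceModule_le_length_cotangentModule`):** for a discrete valuation ring `O`, a
finite free commutative `O`-algebra `T` with augmentation `π` (the `ℓ`-adic `N⁻`-new Hecke
algebra localised at `f_E`), a faithful rank-one `T`-module `M` (the Brandt module
`ℤ[X_{N⁺,N⁻}] ⊗ ℤ_ℓ`) with a perfect `T`-self-adjoint pairing `P`, and a generator `g` of the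
eigenline `M[ker π]` (the Jacquet–Langlands vector `φ_E`):
`length_O (O ⧸ ⟨P g g⟩) ≤ length_O (ker π / (ker π)²)` — i.e. `ord_ℓ ξ_E(N⁺,N⁻) ≤ length(℘/℘²)`,
the Pontryagin dual of which embeds in the adjoint Selmer group `H¹_{L(N⁺,N⁻)}(ℚ, ad⁰E[ℓ^∞])`
(Carayol + representability; the first NEW named fact the line needs). -/
def lenstraSelfPairingStep : Prop :=
  ∀ (O T M : Type) [CommRing O] [IsDomain O] [IsDiscreteValuationRing O]
    [CommRing T] [Algebra O T] [Module.Finite O T] [Module.Free O T]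
    [AddCommGroup M] [Module O M] [Module T M] [IsScalarTower O T M]
    (π : T →ₐ[O] O) (P : M →ₗ[O] M →ₗ[O] O),
    Function.Bijective P → (∀ (b : T) (x y : M), P (b • x) y = P x (b • y)) →
    ∀ (e : T ≃ₗ[T] M) (g : M), (∀ t ∈ RingHom.ker π, t • g = 0) →
      (∀ m : M, (∀ t ∈ RingHom.ker π, t • m = 0) → ∃ r : O, m = r • g) →
        Module.length O (O ⧸ Ideal.span {P g g}) ≤ Module.length O (CotangentModule π)

/-! ## Card B — the 2-adic Eisenstein anchor -/

/-- **First lemma / conjecture K_B (2-adic Eisenstein anchor, Frey generality; kit-testable):**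
there are absolute `A, B` such that for coprime `a, b` with `ab(a+b) ≠ 0`, every modular
parametrisation datum of the Frey curve `E_{a,b}` at its level `N` whose degree is MINIMAL among
the data of that curve satisfies
`v₂(deg) ≤ Σ_{p ∣ N, p odd} v₂(p² − 1) + v₂(T(E)) + A·ω(N) + B`: the `2`-part of the modular
degree of a curve with full rational `2`-torsion is priced by the `2`-adic Eisenstein ideal of
level `N` (level-raising/Tamagawa numerology `(p−1)(p+1)·c_p` per multiplicative prime), not by
the height. -/
def TwoAdicEisensteinAnchor : Prop :=
  ∃ A B : ℕ, ∀ a b : ℤ, IsCoprime a b → a * b * (a + b) ≠ 0 →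
    ∀ (N : ℕ) [NeZero N], (freyCurve a b).conductorNorm ℤ = N →
      ∀ D : ModularParametrizationData (freyCurve a b) N,
        (∀ D' : ModularParametrizationData (freyCurve a b) N, D.deg ≤ D'.deg) →
          padicValNat 2 D.deg ≤
            (∑ p ∈ N.primeFactors.erase 2, padicValNat 2 (p ^ 2 - 1))
              + padicValNat 2 (tamWeight (freyCurve a b)) + A * N.primeFactors.card + B

/-- **Card B, how the anchor enters the crux (the odd part is Card A's business):** with the
anchor, the weighted degree bound reduces to a bound for the ODD part of the minimal degree by
`N^{2+ε} · T_odd(E) / 2^{Σ v₂(p²−1)}`-worth of budget, `T_odd = T / 2^{v₂(T)}` (the odd part of the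
weight — with the full `T` here the product `K_B ∧ OddPart` would only give `deg ≤ … T²`), using the
plain splitting `deg = 2^{v₂(deg)} · oddPart`: then `K_B ∧ OddPart ⟹ deg ≤ C·2^{Aω(N)+B} c² N^{2+ε} T`
and `2^{Aω(N)} ≤ C_ε N^ε`. -/
def OddPartWeightedDegreeBound : Prop :=
  ∀ ε : ℝ, 0 < ε → ∃ C : ℝ, ∀ a b : ℤ, IsCoprime a b → a * b * (a + b) ≠ 0 →
    ∀ (N : ℕ) [NeZero N], (freyCurve a b).conductorNorm ℤ = N →
      ∃ D : ModularParametrizationData (freyCurve a b) N,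
        ((D.deg / 2 ^ padicValNat 2 D.deg : ℕ) : ℝ) ≤
          C * (D.c : ℝ) ^ 2 * (N : ℝ) ^ (2 + ε) *
            ((tamWeight (freyCurve a b) / 2 ^ padicValNat 2 (tamWeight (freyCurve a b)) : ℕ) : ℝ) /
            (2 : ℝ) ^ (∑ p ∈ N.primeFactors.erase 2, padicValNat 2 (p ^ 2 - 1))

end Summit.ABC.ABC.Cruxes.WeightedSzpiroBound.Sketch

end
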